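/-
Copyright (c) 2026 the pub-hodgecm-mathlib formalisation cell (harness21).  Prover seat hodgecm-mathlib-K2E3-p23 (g5), HCML Track B «K2-LIT» ∕ h413
(`stmt-HodgeConjecture-24833`), line `K2_E3_EllipticInputs`, unit U12 «Characters», road «GL-[M6]-sc» (line lead K2E3-p23 (g5), dealer K2E3-plan (g3)),
MEMO «M6sc-BLUEPRINT v4» §1 (ASM): THE ASSEMBLY of the leaf (11-3-split-sc-NE) `sig_K2E3GL3ModUniformizerNonEllEstimates`, MODULO the mixed per-point cancellation.  2026-09-04.
-/
import Summits.HodgeConjecture.HodgeConjecture.Theorems.K2E3GL3ModUniformizerNonEllCancellation   -- ★ p858539 (this seat): `hcanc` packaged (mod HM); brings ★ `hball`, (C-shell B)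
import Summits.HodgeConjecture.HodgeConjecture.Theorems.K2E3GL3ModUniformizerNonEllWeight         -- ★ p858527 (this seat): `hW` machinery; brings ★ coordinates
import Summits.HodgeConjecture.HodgeConjecture.Theorems.K2E3GL3NonEllWeightLocIntegrable          -- ★ p858466 (K2E3-p17 g7): (α) `Φ_α` locally integrable
import Summits.HodgeConjecture.HodgeConjecture.Theorems.K2E3NonEllEstimatesOfRadius                -- ★ p858000 (this seat): ASM-core `nonEllEstimates_of_radius`
import HarnessLib

/-!
# Road «GL-[M6]-sc», ASM: THE LEAF BODY `∃ Fl M, (a.e. convergence) ∧ (a.e. domination) ∧ M ∈ L¹_loc` FOR A GIVEN HEIGHT-BALL EXHAUSTION `Ω`,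
# MODULO the mixed per-point cancellation `HM` (Harish-Chandra 1970, Part VII §3, the non-elliptic half of Theorem 19 for supercuspidal `GL₃`)

Cell `pub/hodgecm-mathlib` (D-0151), Track B «K2-LIT», crux H413 = `stmt-HodgeConjecture-24833`, route of record `HCCMUnconditional`.  Lane
`--supports stmt-HodgeConjecture-24833 --as helper`; THEOREMS ONLY (no `def`, no `instance`, no `notation`, no named-fact hypothesis, no `sorry`); count-neutral.

For `θ = B v₁ (ρ · v₁)` (continuous — `ρ` smooth —, supported in a ball `Ω s₀` — `ρ` supercuspidal, ★ `exists_support_height`), the three conjuncts of the leaf follow from ★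
ASM-core `nonEllEstimates_of_radius` fed with: `hcanc` = ★ `ae_setIntegral_conj_eq_inter_of_hcancMixed` (radius `R x̄ = (A+306)(s₀ + 7h + L + 1)`, mixed half = the
binder `HM`); `hball` = ★ `ae_setIntegral_norm_conj_le_weight` in the coordinates `(h, δ, L)` of ★ `exists_coordinates`; `hW`: the weight is REALISED as
`W = K₃ • (Φ_α · G)`, `Φ_α = 1[¬ compact centraliser]·δ^{-(1∕2+ε)}` (★ (α), `ε = 1∕16`), `G = (a + b h + c L)² q^{3h} δ^{ε}` (★ `locallyIntegrable_mul_weightFactor`), and §1 checks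
`hball`'s right-hand side `≤ W` pointwise off the elliptic set (`(n x̄ : ℝ) = 3(a + b h + c L)²`, `(√δ)⁻¹ = δ^{-(1∕2+ε)}·δ^{ε}`; both sides vanish where `δ = 0`).
The leaf itself then needs only `∃ Ω` (★ `exists_adHeightBall_compactExhaustion_quotScalar`) and the mixed brick `HM`.
* §1 `toReal_bound_eq`, `inv_sqrt_coe_eq_rpow_mul_rpow`; §2 **`nonEllEstimates_of_hcancMixed`**.
HONEST LABEL: HC_CM is proved only modulo the 7 printed citations (2 remaining named inputs: hLiu418 = stmt-HodgeConjecture-24832, h413 = stmt-HodgeConjecture-24833) until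
rung 0 closes; count-neutral helper, closes no socket; CONDITIONAL on the binder `HM` (mixed per-point cancellation), stated not assumed as a fact.

## References
* [HarishChandra1970] Harish-Chandra (notes by G. van Dijk), *Harmonic Analysis on Reductive p-adic Groups*, LNM 162 (1970), Part V §6 Thm 15 p. 63; Part VII §2 Thms 18–20 pp. 69–70, §3 pp. 70–73.
-/

set_option autoImplicit false
-- the mandated namespace repeats the single-problem summit's segment (`HodgeConjecture.HodgeConjecture`)
set_option linter.dupNamespace false

noncomputable section

open MeasureTheory Measure Set Filter Topology
open scoped MatrixGroups NNReal ENNReal WithZero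
open Literature.NumberTheory.Automorphic Literature.NumberTheory.GaloisRepresentations Literature.NumberTheory.GaloisRepresentations.IsNonarchimedeanLocalField
open Summit.HodgeConjecture.HodgeConjecture.Cruxes.H413.K2E3GL3ModUniformizerNonEllCancellation
open Summit.HodgeConjecture.HodgeConjecture.Cruxes.H413.K2E3GL3ModUniformizerNonEllBall
open Summit.HodgeConjecture.HodgeConjecture.Cruxes.H413.K2E3GL3ModUniformizerNonEllWeight
open Summit.HodgeConjecture.HodgeConjecture.Cruxes.H413.K2E3GL3ModUniformizerNonEllCoordinates
open Summit.HodgeConjecture.HodgeConjecture.Cruxes.H413.K2E3GL3NonEllWeightLocIntegrable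
open Summit.HodgeConjecture.HodgeConjecture.Cruxes.H413.K2E3NonEllEstimatesOfRadius
open Summit.HodgeConjecture.HodgeConjecture.Cruxes.H413.K2E3GL3SupercuspOrbitalSliceCancellation

namespace Summit.HodgeConjecture.HodgeConjecture.Cruxes.H413.K2E3GL3ModUniformizerNonEllEstimatesOfMixed

/-! ## §1 Real bookkeeping -/

/-- The road's bound shape in real numbers: `M_θ · (c · (C · n · X)).toReal = M_θ · (c · C.toReal · n · X)`. [folklore] -/
theorem toReal_bound_eq (Mθ : ℝ) (c : ℝ≥0) (C : ℝ≥0∞) (n : ℕ) (X : ℝ≥0) :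
    Mθ * ((c : ℝ≥0∞) * (C * (n : ℝ≥0∞) * (X : ℝ≥0∞))).toReal = Mθ * ((c : ℝ) * C.toReal * n * X) := by
  rw [ENNReal.toReal_mul, ENNReal.toReal_mul, ENNReal.toReal_mul, ENNReal.coe_toReal, ENNReal.coe_toReal, ENNReal.toReal_natCast]; ring

/-- `(√δ)⁻¹ = δ^{-(1∕2+ε)} · δ^{ε}` for `δ > 0`. [folklore] -/
theorem inv_sqrt_coe_eq_rpow_mul_rpow {δ : ℝ≥0} (hδ : δ ≠ 0) (ε : ℝ) :
    ((NNReal.sqrt δ : ℝ≥0) : ℝ)⁻¹ = ((δ : ℝ)) ^ (-(1 / 2 + ε)) * ((δ : ℝ)) ^ ε := by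
  have hpos : 0 < ((δ : ℝ)) := NNReal.coe_pos.2 (pos_iff_ne_zero.2 hδ)
  rw [← Real.rpow_add hpos, show -(1 / 2 + ε) + ε = -(1 / 2 : ℝ) by ring, Real.rpow_neg hpos.le, Real.coe_sqrt, Real.sqrt_eq_rpow]

/-! ## §2 The assembly -/

variable {F : Type*} [Field F] [Valued F ℤᵐ⁰] [ValuativeRel F] [(Valued.v : Valuation F ℤᵐ⁰).Compatible] [IsNonarchimedeanLocalField F] [CharZero F]
  {ϖ : F} (hϖ : Valued.v ϖ = WithZero.exp (-1 : ℤ)) (hϖ0 : ϖ ≠ 0)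
  [((Subgroup.zpowers (Units.mk0 ϖ hϖ0)).map (Matrix.GeneralLinearGroup.scalar (Fin 3))).Normal]
  [MeasurableSpace (GL (Fin 3) F ⧸ (Subgroup.zpowers (Units.mk0 ϖ hϖ0)).map (Matrix.GeneralLinearGroup.scalar (Fin 3)))]
  [BorelSpace (GL (Fin 3) F ⧸ (Subgroup.zpowers (Units.mk0 ϖ hϖ0)).map (Matrix.GeneralLinearGroup.scalar (Fin 3)))]
  (μ : Measure (GL (Fin 3) F ⧸ (Subgroup.zpowers (Units.mk0 ϖ hϖ0)).map (Matrix.GeneralLinearGroup.scalar (Fin 3)))) [μ.IsHaarMeasure]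
  (r : SmoothIrrep (GL (Fin 3) F ⧸ (Subgroup.zpowers (Units.mk0 ϖ hϖ0)).map (Matrix.GeneralLinearGroup.scalar (Fin 3)))) (hsc : r.ρ.IsSupercuspidal)
  (B : r.V →ₗ⋆[ℂ] r.V →ₗ[ℂ] ℂ)
  (hBinv : ∀ (g : GL (Fin 3) F ⧸ (Subgroup.zpowers (Units.mk0 ϖ hϖ0)).map (Matrix.GeneralLinearGroup.scalar (Fin 3))) (x y : r.V), B (r.ρ g x) (r.ρ g y) = B x y)
  (v₁ : r.V)
  (Ω : CompactExhaustion (GL (Fin 3) F ⧸ (Subgroup.zpowers (Units.mk0 ϖ hϖ0)).map (Matrix.GeneralLinearGroup.scalar (Fin 3))))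
  (hmem : ∀ (m : ℕ) (g : GL (Fin 3) F),
    (QuotientGroup.mk g : GL (Fin 3) F ⧸ (Subgroup.zpowers (Units.mk0 ϖ hϖ0)).map (Matrix.GeneralLinearGroup.scalar (Fin 3))) ∈ Ω m ↔
      ∀ i j k l, Valued.v (ϖ ^ m * ((g : Matrix (Fin 3) (Fin 3) F) i j * ((g⁻¹ : GL (Fin 3) F) : Matrix (Fin 3) (Fin 3) F) k l)) ≤ 1)
  (hK : ∀ (m : ℕ) (k : GL (Fin 3) F), k ∈ glInt 3 F → ∀ x : GL (Fin 3) F ⧸ (Subgroup.zpowers (Units.mk0 ϖ hϖ0)).map (Matrix.GeneralLinearGroup.scalar (Fin 3)),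
    ((QuotientGroup.mk k : GL (Fin 3) F ⧸ _) * x ∈ Ω m ↔ x ∈ Ω m) ∧ (x * (QuotientGroup.mk k : GL (Fin 3) F ⧸ _) ∈ Ω m ↔ x ∈ Ω m))

include hϖ hsc hBinv hmem hK in
/-- **THE LEAF BODY FOR A GIVEN EXHAUSTION, MODULO THE MIXED PER-POINT CANCELLATION `HM`.**  For `θ = B v₁ (ρ · v₁)`:
`∃ Fl M, (∀ᵐ g, Z(g) not compact → ∫_{Ω n} θ(x g x⁻¹) → Fl g) ∧ (∀ n, ∀ᵐ g, Z(g) not compact → ‖∫_{Ω n} θ(x g x⁻¹)‖ ≤ M g) ∧ M ∈ L¹_loc(μ)` — the three conjuncts of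
`sig_K2E3GL3ModUniformizerNonEllEstimates` ∕ the hypothesis `hNE` of ★ B6-final.  `HM` = the mixed per-point `hcanc` at an integral representative in mixed normal form with
radius `≤ A(s₀ + h + L₀ + 1)` (the one brick the road still owes).
[cite: HarishChandra1970, Part V §6 Thm 15 p. 63; Part VII §2 Thms 18–20 pp. 69–70, §3 pp. 70–73] -/
theorem nonEllEstimates_of_hcancMixed (A : ℕ)
    (HM : ∀ s₀ : ℕ, (∀ g : GL (Fin 3) F ⧸ (Subgroup.zpowers (Units.mk0 ϖ hϖ0)).map (Matrix.GeneralLinearGroup.scalar (Fin 3)), B v₁ (r.ρ g v₁) ≠ 0 → g ∈ Ω s₀) →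
      ∀ (g₁ y : GL (Fin 3) F) (e : Fin 5 → F) (h L₀ : ℕ),
      Irreducible ((!![e 0, e 1; e 2, e 3] : Matrix (Fin 2) (Fin 2) F)).charpoly →
      (g₁ : Matrix (Fin 3) (Fin 3) F) = (y : Matrix (Fin 3) (Fin 3) F) * !![e 0, e 1, 0; e 2, e 3, 0; 0, 0, e 4] * ((y⁻¹ : GL (Fin 3) F) : Matrix (Fin 3) (Fin 3) F) →
      (∀ i j, Valued.v ((g₁ : Matrix (Fin 3) (Fin 3) F) i j) ≤ 1) → (∀ i j, Valued.v (ϖ ^ h * ((g₁⁻¹ : GL (Fin 3) F) : Matrix (Fin 3) (Fin 3) F) i j) ≤ 1) →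
      Valued.v ((g₁ : Matrix (Fin 3) (Fin 3) F)).charpoly.discr = WithZero.exp (-(L₀ : ℤ)) →
      ∃ R₀ : ℕ, R₀ ≤ A * (s₀ + h + L₀ + 1) ∧ ∀ n : ℕ,
        ∫ z in Ω n, B v₁ (r.ρ (z * QuotientGroup.mk g₁ * z⁻¹) v₁) ∂μ = ∫ z in Ω n ∩ Ω R₀, B v₁ (r.ρ (z * QuotientGroup.mk g₁ * z⁻¹) v₁) ∂μ) :
    ∃ (Fl : (GL (Fin 3) F ⧸ (Subgroup.zpowers (Units.mk0 ϖ hϖ0)).map (Matrix.GeneralLinearGroup.scalar (Fin 3))) → ℂ)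
      (M : (GL (Fin 3) F ⧸ (Subgroup.zpowers (Units.mk0 ϖ hϖ0)).map (Matrix.GeneralLinearGroup.scalar (Fin 3))) → ℝ),
      (∀ᵐ g ∂μ, ¬ IsCompact ((Subgroup.centralizer ({g} : Set (GL (Fin 3) F ⧸ (Subgroup.zpowers (Units.mk0 ϖ hϖ0)).map (Matrix.GeneralLinearGroup.scalar (Fin 3))))) :
          Set (GL (Fin 3) F ⧸ (Subgroup.zpowers (Units.mk0 ϖ hϖ0)).map (Matrix.GeneralLinearGroup.scalar (Fin 3)))) →
        Tendsto (fun n => ∫ x in Ω n, B v₁ (r.ρ (x * g * x⁻¹) v₁) ∂μ) atTop (𝓝 (Fl g))) ∧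
      (∀ n, ∀ᵐ g ∂μ, ¬ IsCompact ((Subgroup.centralizer ({g} : Set (GL (Fin 3) F ⧸ (Subgroup.zpowers (Units.mk0 ϖ hϖ0)).map (Matrix.GeneralLinearGroup.scalar (Fin 3))))) :
          Set (GL (Fin 3) F ⧸ (Subgroup.zpowers (Units.mk0 ϖ hϖ0)).map (Matrix.GeneralLinearGroup.scalar (Fin 3)))) →
        ‖∫ x in Ω n, B v₁ (r.ρ (x * g * x⁻¹) v₁) ∂μ‖ ≤ M g) ∧
      LocallyIntegrable M μ := by
  -- §0 frame
  letI : MeasurableSpace F := borel F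
  haveI : BorelSpace F := ⟨rfl⟩
  letI : MeasurableSpace (GL (Fin 3) F) := borel _
  haveI : BorelSpace (GL (Fin 3) F) := ⟨rfl⟩
  haveI : T2Space (GL (Fin 3) F ⧸ (Subgroup.zpowers (Units.mk0 ϖ hϖ0)).map (Matrix.GeneralLinearGroup.scalar (Fin 3))) :=
    K2E3GL3ModCocompactCentral.t2Space_quotScalar _ (K2E3GL3ModUniformizerCocompact.isClosed_zpowers_uniformizer hϖ hϖ0)
  have h2 : (2 : F) ≠ 0 := two_ne_zero
  -- the test function `θ = B v₁ (ρ · v₁)`: continuous, supported in `Ω s₀`, bounded by `Mθ`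
  have hθc : Continuous fun x : GL (Fin 3) F ⧸ (Subgroup.zpowers (Units.mk0 ϖ hϖ0)).map (Matrix.GeneralLinearGroup.scalar (Fin 3)) => B v₁ (r.ρ x v₁) :=
    ((Representation.IsSmooth.isLocallyConstant_apply r.ρ r.isSmooth v₁).comp fun w : r.V => B v₁ w).continuous
  obtain ⟨s₀, hs₀⟩ := exists_support_height hϖ hϖ0 r.ρ r.isSmooth hsc hBinv v₁ v₁ Ω
  have hsupp : ∀ x, x ∉ Ω s₀ → B v₁ (r.ρ x v₁) = 0 := fun x hx => by_contra (fun h => hx (hs₀ x h))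
  obtain ⟨Mθ, hMθ⟩ := hθc.bounded_above_of_compact_support (HasCompactSupport.intro (Ω.isCompact s₀) hsupp)
  -- the coordinates and the two packaged estimates
  obtain ⟨hgt, δ, L, hm, hhgt, hhgt', hδc, hδ, hLm, hL1, hL2, -, -⟩ := exists_coordinates hϖ hϖ0 Ω
  obtain ⟨c₀, C, hC, hballθ⟩ := ae_setIntegral_norm_conj_le_weight (E := ℂ) hϖ hϖ0 μ h2 Ω hmem
  -- the radius and the weight
  obtain ⟨R, hRdef⟩ : ∃ R : GL (Fin 3) F ⧸ (Subgroup.zpowers (Units.mk0 ϖ hϖ0)).map (Matrix.GeneralLinearGroup.scalar (Fin 3)) → ℕ,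
      ∀ x, R x = (A + 306) * (s₀ + 7 * hgt x + L x + 1) := ⟨_, fun _ => rfl⟩
  set ε : ℝ := 1 / 16 with hεdef
  have hε0 : 0 < ε := by norm_num [hεdef]
  have hε8 : ε < 1 / 8 := by norm_num [hεdef]
  set q : ℝ := ((residueFieldCard F : ℝ≥0) : ℝ) with hqdef
  have hq1 : 1 < q := by rw [hqdef]; exact_mod_cast one_lt_residueFieldCard_nnreal (F := F)
  have hq0 : 0 < q := zero_lt_one.trans hq1
  set a : ℝ := 2 * ((A : ℝ) + 306) * ((s₀ : ℝ) + 1) + 1 with hadef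
  set b : ℝ := 14 * ((A : ℝ) + 306) + 24 with hbdef
  set c : ℝ := 2 * ((A : ℝ) + 306) + 2 with hcdef
  have ha : 0 ≤ a := by positivity
  have hb : 0 ≤ b := by positivity
  set t : ℝ≥0 := (normAbs F (2 : F))⁻¹ * (residueFieldCard F : ℝ≥0) ^ (s₀ + 1) with htdef
  set K₃ : ℝ := Mθ * ((c₀ : ℝ) * (C s₀).toReal) * (t : ℝ) * 3 with hK₃def
  obtain ⟨Φ, hΦdef⟩ : ∃ Φ : GL (Fin 3) F ⧸ (Subgroup.zpowers (Units.mk0 ϖ hϖ0)).map (Matrix.GeneralLinearGroup.scalar (Fin 3)) → ℝ, ∀ x, Φ x =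
      {y : GL (Fin 3) F ⧸ (Subgroup.zpowers (Units.mk0 ϖ hϖ0)).map (Matrix.GeneralLinearGroup.scalar (Fin 3)) |
        ¬ IsCompact ((Subgroup.centralizer ({y} : Set (GL (Fin 3) F ⧸ (Subgroup.zpowers (Units.mk0 ϖ hϖ0)).map (Matrix.GeneralLinearGroup.scalar (Fin 3))))) :
          Set (GL (Fin 3) F ⧸ (Subgroup.zpowers (Units.mk0 ϖ hϖ0)).map (Matrix.GeneralLinearGroup.scalar (Fin 3))))}.indicator
      (fun y => ((δ y : ℝ)) ^ (-(1 / 2 + ε))) x := ⟨_, fun _ => rfl⟩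
  have hΦ : LocallyIntegrable Φ μ := by
    have hΦeq : Φ = fun x => {y : GL (Fin 3) F ⧸ (Subgroup.zpowers (Units.mk0 ϖ hϖ0)).map (Matrix.GeneralLinearGroup.scalar (Fin 3)) |
        ¬ IsCompact ((Subgroup.centralizer ({y} : Set (GL (Fin 3) F ⧸ (Subgroup.zpowers (Units.mk0 ϖ hϖ0)).map (Matrix.GeneralLinearGroup.scalar (Fin 3))))) :
          Set (GL (Fin 3) F ⧸ (Subgroup.zpowers (Units.mk0 ϖ hϖ0)).map (Matrix.GeneralLinearGroup.scalar (Fin 3))))}.indicator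
      (fun y => ((δ y : ℝ)) ^ (-(1 / 2 + ε))) x := funext hΦdef
    rw [hΦeq]; exact locallyIntegrable_indicator_not_isCompact_centralizer_rpow_neg hϖ hϖ0 μ δ hδ hε0 hε8
  obtain ⟨G, hGdef⟩ : ∃ G : GL (Fin 3) F ⧸ (Subgroup.zpowers (Units.mk0 ϖ hϖ0)).map (Matrix.GeneralLinearGroup.scalar (Fin 3)) → ℝ, ∀ x, G x =
      (a + b * (hgt x : ℝ) + c * (L x : ℝ)) ^ 2 * q ^ (3 * hgt x) * ((δ x : ℝ)) ^ ε := ⟨_, fun _ => rfl⟩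
  have hGeq : G = fun x => (a + b * (hgt x : ℝ) + c * (L x : ℝ)) ^ 2 * q ^ (3 * hgt x) * ((δ x : ℝ)) ^ ε := funext hGdef
  have hL0 : ∀ x, 0 < L x → δ x < ((q⁻¹ : ℝ).toNNReal) ^ (L x - 1) := fun x hx => by
    have : (q⁻¹ : ℝ).toNNReal = (residueFieldCard F : ℝ≥0)⁻¹ := by rw [hqdef, ← NNReal.coe_inv, Real.toNNReal_coe]
    rw [this]; exact hL2 x hx
  have hW : LocallyIntegrable (K₃ • fun x => Φ x * G x) μ := by
    rw [hGeq]; exact (locallyIntegrable_mul_weightFactor Ω hΦ hm hhgt' hδc hLm hq1 hL0 ha hb hε0 (c := c)).smul K₃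
  -- ★ ASM-core
  refine nonEllEstimates_of_radius μ hθc Ω
    (fun x => IsCompact ((Subgroup.centralizer ({x} : Set (GL (Fin 3) F ⧸ (Subgroup.zpowers (Units.mk0 ϖ hϖ0)).map (Matrix.GeneralLinearGroup.scalar (Fin 3))))) :
      Set (GL (Fin 3) F ⧸ (Subgroup.zpowers (Units.mk0 ϖ hϖ0)).map (Matrix.GeneralLinearGroup.scalar (Fin 3)))))
    R (K₃ • fun x => Φ x * G x) (fun n => ?_) ?_ hW
  · -- `hcanc`
    have hReq : R = fun x => (A + 306) * (s₀ + 7 * hgt x + L x + 1) := funext hRdef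
    rw [hReq]
    exact ae_setIntegral_conj_eq_inter_of_hcancMixed hϖ hϖ0 r.ρ r.isSmooth hsc hBinv v₁ v₁ Ω hmem hK μ hs₀ hgt δ L hhgt hδ hL1 A (HM s₀ hs₀) n
  · -- `hball`: the packaged bound, then `RHS ≤ W` pointwise
    filter_upwards [hballθ (fun x => B v₁ (r.ρ x v₁)) Mθ s₀ hMθ hsupp hgt δ L R hhgt hδ hL1] with x hx hnc
    refine (hx hnc).trans ?_
    have hMθ0 : 0 ≤ Mθ := (norm_nonneg _).trans (hMθ 1)
    have hK₃0 : 0 ≤ K₃ := by rw [hK₃def]; positivity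
    rw [toReal_bound_eq, Pi.smul_apply, smul_eq_mul]
    have hΦx : Φ x = ((δ x : ℝ)) ^ (-(1 / 2 + ε)) := by rw [hΦdef]; exact indicator_of_mem hnc _
    have hn : (((3 * (2 * (R x + (12 * hgt x + L x)) + 1) ^ 2 : ℕ)) : ℝ) = 3 * (a + b * (hgt x : ℝ) + c * (L x : ℝ)) ^ 2 := by
      rw [hRdef]; push_cast; ring
    by_cases hδ0 : δ x = 0
    · -- both sides vanish
      have hX : ((t * ((residueFieldCard F : ℝ≥0) ^ (3 * hgt x) * (NNReal.sqrt (δ x))⁻¹) : ℝ≥0) : ℝ) = 0 := by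
        rw [hδ0, NNReal.sqrt_zero, inv_zero, mul_zero, mul_zero, NNReal.coe_zero]
      rw [hX, mul_zero, mul_zero]
      refine mul_nonneg hK₃0 (mul_nonneg ?_ ?_)
      · rw [hΦx]; exact Real.rpow_nonneg (δ x).2 _
      · rw [hGdef]; exact mul_nonneg (mul_nonneg (sq_nonneg _) (pow_nonneg hq0.le _)) (Real.rpow_nonneg (δ x).2 _)
    · -- equality
      have hs : (Real.sqrt ((δ x : ℝ)))⁻¹ = ((δ x : ℝ)) ^ (-(1 / 2 + ε)) * ((δ x : ℝ)) ^ ε := by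
        rw [← Real.coe_sqrt]; exact inv_sqrt_coe_eq_rpow_mul_rpow hδ0 ε
      rw [hn, hΦx, hGdef, hK₃def, htdef, hqdef]
      simp only [NNReal.coe_mul, NNReal.coe_inv, NNReal.coe_pow, Real.coe_sqrt]
      rw [hs]
      exact le_of_eq (by ring)

end Summit.HodgeConjecture.HodgeConjecture.Cruxes.H413.K2E3GL3ModUniformizerNonEllEstimatesOfMixed

end
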